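import Summits.BirchSwinnertonDyer.BirchSwinnertonDyer.Theorems.ResidualThetaTransportAtTwoResidualSignedLambdaLowerCMAtTwoDeepHalfAwayTwoLocKerTransfer
import Summits.BirchSwinnertonDyer.BirchSwinnertonDyer.Theorems.ResidualThetaTransportAtTwoResidualSignedLambdaLowerCMAtTwoDeepHalfAwayTwoCharacterReadback
import HarnessLib

/-!
# S4₀'s levelwise orthogonality `hT` FROM the text's hypothesis: if `χ : PAway` kills `∑ w, ∑ᶠ c, χ w c (locAway s w c)` for every
# `s ∈ selRelSubgroup` with `locKer … v s = 0`, then the layer classes `b w c` representing `χ w c ∘ j_{n,k}` are orthogonal, in the summed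
# layer-pairing currency, to every test class of the socket p697362 — and hence so is any family `t` read back through them

Route `ResidualThetaTransportAtTwo` (RTT), crux RSL_g `ResidualSignedLambdaLowerCMAtTwo` (stmt-BirchSwinnertonDyer-22608); seat
`prover-bsd-wall-tp2-p2x` g19 (`--supports 22608 --as helper`, closes nothing). THEOREMS ONLY (no definition, no named fact, no instance,
no notation, no `sorry`). BSD is not proved by any of this; RSL_g is not proved here.

WHY. The registered S4₀ text `stub_deepHalfAwayTwo` (v3a/v3b) has ONE hypothesis on `χ`,
`(H₀) ∀ s ∈ selRelSubgroup, locKer … π.v s = 0 → ∑ w : ↥S₀, ∑ᶠ c : Cosets κ w, χ w c (locAway s w c) = 0`, while the assembled socket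
`DeepHalfAssemblyAway.exists_iwasawaH1_prescribed_of_levelwise_orthogonal` (p697362) wants, per `(n, k)`, the LEVELWISE orthogonality `hT`:
for every layer class `a ∈ H¹(Γ_n, A_ρ[2^k])` unramified off `S₀ ∪ {2}`, trivial at `∞` and ZERO at `v ∣ 2` (Shapiro currency),
`∑_{w ∈ S₀} ⟨t n k w, loc_w(H¹(Ψ)(Sh a))⟩ = 0`. This file derives `hT` from `(H₀)`:

* §1 (pure algebra) `valSmulHom` bookkeeping: `t ↦ t.val • N⁻¹` is additive (`val_smul_add`, `sum_val_smul`), so a vanishing sum of values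
  in `ℚ/ℤ` is a vanishing sum in `ℤ/N` (`sum_eq_zero_of_sum_val_smul_eq_zero`, by `AwayCharacterReadback.zmod_eq_of_val_smul_eq`).
* §2 **`sum_layerPairingH1Of_eq_zero_of_awayHyp`** — for `a` as above: the transferred class `τ a` (p692705
  `transferH1_mem_relaxed_strict_of_shapiroLift`) lies in `selRelSubgroup` with `locKer v (τ a) = 0` (`AwayLocKerTransfer.locKer_eq_zero_of_mem_awayKer`),
  `(H₀)` applies, each term is `χ w c (jAway (layerLocOf (conj_{c.out} a)))` (`locAway_transferH1`) `= (⟨b w c, loc_n(c.out · a)⟩).val • 2^{-k}`,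
  hence **`∑ w, ∑ c, ⟨b w c, loc_n(c.out · a)⟩_{n,2^k,w} = 0` in `ℤ/2^k`**.
* §3 **`sum_localTatePairingZMod_eq_zero_of_awayHyp`** — the same read on any family `t w` with the readback
  `⟨t w, loc_w(H¹(Ψ)(Sh a))⟩ = ∑ c, ⟨b w c, loc_n(c.out · a)⟩` (the output of `AwayCharacterReadback.exists_local_of_characters`): p697362's `hT`
  at `(n, k)`, summed over `w : ↥S₀`.

References: [MilneADT2006] I §6 (proof of Prop. 6.9), I Thm. 4.10; [NeukirchSchmidtWingberg2008] I §5–§6; [GreenbergVatsal2000] §2; [Greenberg1989] §1 p. 98;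
[Kato2004Asterisque] §17.13; [Kobayashi2003] (8.23).
-/

set_option autoImplicit false
-- the Theorems namespace of this sub repeats the summit name by design (D-0017 nested layout)
set_option linter.dupNamespace false

noncomputable section

open scoped Classical

namespace Summit.BirchSwinnertonDyer.BirchSwinnertonDyer.Theorems

namespace ThetaTransport.AwayOrthogonal

open CategoryTheory Function Field NumberField IsDedekindDomain
  Literature.NumberTheory.EllipticCurves Literature.NumberTheory.EllipticCurves.CyclotomicLayer
  Literature.NumberTheory.EllipticCurves.GreenbergSelmer Literature.NumberTheory.EllipticCurves.GreenbergVatsal2000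
  Literature.NumberTheory.GaloisRepresentations Literature.NumberTheory.GaloisRepresentations.DiscreteGaloisModule
  Literature.NumberTheory.GaloisCohomology ZpExtension
  Summit.BirchSwinnertonDyer.BirchSwinnertonDyer.Theorems.OnePair
open ThetaTransport.AwayCharacterReadback ThetaTransport.AwayLocKerTransfer

/-! ## §1 Pure algebra: sums in the value currency `t ↦ t.val • N⁻¹` -/

section Algebra

variable {N : ℕ} [NeZero N]

/-- `t ↦ t.val • N⁻¹` is additive: `(t + t').val • N⁻¹ = t.val • N⁻¹ + t'.val • N⁻¹` (`(t + t').val ≡ t.val + t'.val (mod N)` and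
`N • N⁻¹ = 0`). [cite: Kato2004Asterisque, §17.13 (p. 279)] -/
theorem val_smul_add (t t' : ZMod N) :
    (t + t').val • ((((N : ℚ))⁻¹ : ℚ) : AddCircle (1 : ℚ)) =
      t.val • ((((N : ℚ))⁻¹ : ℚ) : AddCircle (1 : ℚ)) + t'.val • ((((N : ℚ))⁻¹ : ℚ) : AddCircle (1 : ℚ)) := by
  set u : AddCircle (1 : ℚ) := ((((N : ℚ))⁻¹ : ℚ) : AddCircle (1 : ℚ)) with hu
  have hN0 : N • u = 0 := by rw [← addOrderOf_inv_natCast (N := N)]; exact addOrderOf_nsmul_eq_zero u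
  have h : t.val + t'.val = (t + t').val + N * ((t.val + t'.val) / N) := by
    rw [ZMod.val_add]; exact (Nat.mod_add_div _ _).symm
  rw [← add_smul, h, add_smul, mul_comm, mul_smul, hN0, smul_zero, add_zero]

/-- Sums: `(∑ i, m i).val • N⁻¹ = ∑ i, (m i).val • N⁻¹`. [cite: Kato2004Asterisque, §17.13 (p. 279)] -/
theorem sum_val_smul {ι : Type*} (s : Finset ι) (m : ι → ZMod N) :
    (∑ i ∈ s, m i).val • ((((N : ℚ))⁻¹ : ℚ) : AddCircle (1 : ℚ)) = ∑ i ∈ s, (m i).val • ((((N : ℚ))⁻¹ : ℚ) : AddCircle (1 : ℚ)) := by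
  induction s using Finset.induction_on with
  | empty => simp
  | insert i s hi ih => rw [Finset.sum_insert hi, Finset.sum_insert hi, val_smul_add, ih]

/-- A vanishing sum in the value currency is a vanishing sum in `ℤ/N`. [cite: Kato2004Asterisque, §17.13 (p. 279)] -/
theorem sum_eq_zero_of_sum_val_smul_eq_zero {ι : Type*} (s : Finset ι) (m : ι → ZMod N)
    (h : ∑ i ∈ s, (m i).val • ((((N : ℚ))⁻¹ : ℚ) : AddCircle (1 : ℚ)) = 0) : ∑ i ∈ s, m i = 0 := by
  apply zmod_eq_of_val_smul_eq (N := N)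
  rw [sum_val_smul, h, ZMod.val_zero, zero_smul]

end Algebra

/-! ## §2 `(H₀)` on the transferred test class: the layer classes `b w c` are orthogonal to the test classes -/

section Ortho

-- the `ρ`-coefficient coinduced modules and their Tate duals make elaboration of these statements expensive (cf. p694426/p697362)
set_option maxHeartbeats 1600000

variable (S : Set (PadicAlgCl 2)) (ρ : FramedGaloisRep ℚ ↥(padicCoeffIntegers S) 2)
  (ePk : ∀ k : ℕ, ↥(AddSubgroup.torsionBy (Cofree ρ ↥(padicCoeffField S)) ((2 ^ k : ℕ) : ℤ)) →
    ↥(AddSubgroup.torsionBy (Cofree ρ ↥(padicCoeffField S)) ((2 ^ k : ℕ) : ℤ)) → AlgebraicClosure ℚ)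
  (hμPk : ∀ k a b, ePk k a b ^ (2 ^ k) = 1)
  (hadd₁Pk : ∀ k a₁ a₂ b, ePk k (a₁ + a₂) b = ePk k a₁ b * ePk k a₂ b)
  (hadd₂Pk : ∀ k a b₁ b₂, ePk k a (b₁ + b₂) = ePk k a b₁ * ePk k a b₂)
  (hgalPk : ∀ k (σ : absoluteGaloisGroup ℚ) (a b : ↥(AddSubgroup.torsionBy (Cofree ρ ↥(padicCoeffField S)) ((2 ^ k : ℕ) : ℤ))),
    σ • ePk k a b = ePk k (cofreeTorsionGaloisModule S ρ _ σ a) (cofreeTorsionGaloisModule S ρ _ σ b))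
  (κ : ZpExtension ℚ 2) (S₀ : Finset (HeightOneSpectrum (𝓞 ℚ)))
  (hρ : ∀ w : HeightOneSpectrum (𝓞 ℚ), w ∉ S₀ → ((2 : ℕ) : 𝓞 ℚ) ∉ w.asIdeal → ρ.IsUnramifiedAt w)
  (v : HeightOneSpectrum (𝓞 ℚ)) (hv : ((2 : ℕ) : 𝓞 ℚ) ∈ v.asIdeal)
  (χ : PAway S κ ρ S₀)
  (hH : ∀ s : subgroupH1 κ.kerSubgroup (Cofree ρ ↥(padicCoeffField S)), s ∈ selRelSubgroup S κ ρ S₀ → locKer S κ ρ v s = 0 →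
    ∑ w : ↥S₀, ∑ᶠ c : Cosets κ (w : HeightOneSpectrum (𝓞 ℚ)), χ w c (locAway S κ ρ S₀ s w c) = 0)
  (n k : ℕ) [Fintype (absoluteGaloisGroup ℚ ⧸ κ.layerSubgroup n)] [∀ w : ↥S₀, Fintype (Cosets κ (w : HeightOneSpectrum (𝓞 ℚ)))]
  {s : absoluteGaloisGroup ℚ ⧸ κ.layerSubgroup n → absoluteGaloisGroup ℚ}
  (hs : ∀ x : absoluteGaloisGroup ℚ ⧸ κ.layerSubgroup n, (s x : absoluteGaloisGroup ℚ ⧸ κ.layerSubgroup n) = x)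
  (hs1 : s ((1 : absoluteGaloisGroup ℚ) : absoluteGaloisGroup ℚ ⧸ κ.layerSubgroup n) = 1)
  (b : ∀ w : ↥S₀, Cosets κ (w : HeightOneSpectrum (𝓞 ℚ)) → Dlev S κ ρ w n k)
  (hb : ∀ (w : ↥S₀) (c : Cosets κ (w : HeightOneSpectrum (𝓞 ℚ))) (y : Dlev S κ ρ w n k),
    χ w c (jAway S κ ρ w n k y) =
      (layerPairingH1Of (cofreeTorsionGaloisModule S ρ ((2 ^ k : ℕ) : ℤ)) (2 ^ k) (ePk k) (hμPk k) (hadd₁Pk k) (hadd₂Pk k) (hgalPk k)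
          κ w n (b w c) y).val • ((((2 : ℚ) ^ k)⁻¹ : ℚ) : AddCircle (1 : ℚ)))
  (a : H1 (cofreeTorsionGaloisModule S ρ ((2 ^ k : ℕ) : ℤ)) (κ.layerSubgroup n))
  (hur : ∀ w : HeightOneSpectrum (𝓞 ℚ), w ∉ S₀ → ((2 : ℕ) : 𝓞 ℚ) ∉ w.asIdeal →
    galoisCohomology.localization
        ((cofreeTorsionGaloisModule S ρ ((2 ^ k : ℕ) : ℤ)).coind (κ.layerSubgroup n) (κ.isOpen_layerSubgroup n)) (Sum.inr w) 1
        (shapiroLift (cofreeTorsionGaloisModule S ρ ((2 ^ k : ℕ) : ℤ)).toTopRep (κ.layerSubgroup n) (κ.isOpen_layerSubgroup n) hs hs1 a) ∈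
      unramifiedSubgroup (GaloisRep.toLocal w
        ((cofreeTorsionGaloisModule S ρ ((2 ^ k : ℕ) : ℤ)).coind (κ.layerSubgroup n) (κ.isOpen_layerSubgroup n))) 1)
  (hinf : ∀ w : InfinitePlace ℚ,
    galoisCohomology.localization
        ((cofreeTorsionGaloisModule S ρ ((2 ^ k : ℕ) : ℤ)).coind (κ.layerSubgroup n) (κ.isOpen_layerSubgroup n)) (Sum.inl w) 1
        (shapiroLift (cofreeTorsionGaloisModule S ρ ((2 ^ k : ℕ) : ℤ)).toTopRep (κ.layerSubgroup n) (κ.isOpen_layerSubgroup n) hs hs1 a) = 0)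
  (hp : ∀ v' : HeightOneSpectrum (𝓞 ℚ), ((2 : ℕ) : 𝓞 ℚ) ∈ v'.asIdeal →
    galoisCohomology.localization
        ((cofreeTorsionGaloisModule S ρ ((2 ^ k : ℕ) : ℤ)).coind (κ.layerSubgroup n) (κ.isOpen_layerSubgroup n)) (Sum.inr v') 1
        (shapiroLift (cofreeTorsionGaloisModule S ρ ((2 ^ k : ℕ) : ℤ)).toTopRep (κ.layerSubgroup n) (κ.isOpen_layerSubgroup n) hs hs1 a) = 0)

include hρ hv hH hb hur hinf hp in
/-- **`(H₀)` ⟹ the layer classes representing `χ` are orthogonal to every test class.** For `a ∈ H¹(Γ_n, A_ρ[2^k])` unramified off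
`S₀ ∪ {2}`, trivial at `∞` and ZERO at every `v' ∣ 2` (Shapiro currency): its transfer `τ a ∈ H¹(Γ_∞, A_ρ)` (p692705) lies in `selRelSubgroup`
with `locKer v (τ a) = 0`, so `(H₀)` gives `∑ w, ∑ᶠ c, χ w c (locAway (τ a) w c) = 0`; each term is `χ w c (jAway (loc_n(c.out · a)))`
(`locAway_transferH1`) `= (⟨b w c, loc_n(c.out · a)⟩).val • 2^{-k}`, and the value currency is injective on sums:
`∑ w, ∑ c, ⟨b w c, loc_n(c.out · a)⟩_{n,2^k,w} = 0` in `ℤ/2^k`. [cite: MilneADT2006, Ch. I §6 (proof of Prop. 6.9)]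
[cite: GreenbergVatsal2000, §2 pp. 16–17, 23] [cite: Greenberg1989, §1 p. 98 (3)] [cite: Kato2004Asterisque, §17.13 (p. 279)] -/
theorem sum_layerPairingH1Of_eq_zero_of_awayHyp :
    ∑ w : ↥S₀, ∑ c : Cosets κ (w : HeightOneSpectrum (𝓞 ℚ)),
      layerPairingH1Of (cofreeTorsionGaloisModule S ρ ((2 ^ k : ℕ) : ℤ)) (2 ^ k) (ePk k) (hμPk k) (hadd₁Pk k) (hadd₂Pk k) (hgalPk k)
        κ w n (b w c)
        (layerLocOf (cofreeTorsionGaloisModule S ρ ((2 ^ k : ℕ) : ℤ)) κ w n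
          (conjMap (cofreeTorsionGaloisModule S ρ ((2 ^ k : ℕ) : ℤ)).toTopRep (κ.layerSubgroup n) c.out 1 a)) = 0 := by
  haveI : NeZero (2 ^ k) := ⟨pow_ne_zero k two_ne_zero⟩
  -- the transferred class and its three properties
  obtain ⟨h1, h2, h3⟩ := CofreeSelmerTransfer.transferH1_mem_relaxed_strict_of_shapiroLift S ρ κ ((2 ^ k : ℕ) : ℤ) n hs hs1
    (S₀ := (↑S₀ : Set (HeightOneSpectrum (𝓞 ℚ)))) (fun w hw h2 ↦ hρ w (fun h ↦ hw (Finset.mem_coe.2 h)) h2) a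
    (fun w hw h2 ↦ hur w (fun h ↦ hw (Finset.mem_coe.2 h)) h2) hinf hp
  set τa := resOfLe (Cofree ρ ↥(padicCoeffField S)) (κ.kerSubgroup_le_layerSubgroup n)
    (pushH1 (κ.layerSubgroup n) (AddSubgroup.torsionBy (Cofree ρ ↥(padicCoeffField S)) ((2 ^ k : ℕ) : ℤ)).subtype
      (CofreeSelmerTransfer.torsionBy_subtype_smul S ρ ((2 ^ k : ℕ) : ℤ)) a) with hτa
  have hsel : τa ∈ selRelSubgroup S κ ρ S₀ := (mem_selRelSubgroup_iff S κ ρ S₀ τa).2 ⟨h1, h2⟩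
  have hguard : locKer S κ ρ v τa = 0 := by
    have h := h3 v hv 1
    have h1' : conjH1 κ.kerSubgroup (Cofree ρ ↥(padicCoeffField S)) (1 : absoluteGaloisGroup ℚ) τa = τa := by
      rw [(conjH1_one_holds κ.kerSubgroup (Cofree ρ ↥(padicCoeffField S)) : conjH1 κ.kerSubgroup _ 1 = AddMonoidHom.id _)]
      rfl
    rw [h1'] at h
    exact locKer_eq_zero_of_mem_awayKer S κ ρ v h
  -- `(H₀)` on `τ a`, read in layer currency
  have hsum := hH τa hsel hguard
  have hterm : ∀ (w : ↥S₀) (c : Cosets κ (w : HeightOneSpectrum (𝓞 ℚ))), χ w c (locAway S κ ρ S₀ τa w c) =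
      (layerPairingH1Of (cofreeTorsionGaloisModule S ρ ((2 ^ k : ℕ) : ℤ)) (2 ^ k) (ePk k) (hμPk k) (hadd₁Pk k) (hadd₂Pk k) (hgalPk k)
          κ w n (b w c)
          (layerLocOf (cofreeTorsionGaloisModule S ρ ((2 ^ k : ℕ) : ℤ)) κ w n
            (conjMap (cofreeTorsionGaloisModule S ρ ((2 ^ k : ℕ) : ℤ)).toTopRep (κ.layerSubgroup n) c.out 1 a))).val •
        ((((2 : ℚ) ^ k)⁻¹ : ℚ) : AddCircle (1 : ℚ)) := by
    intro w c
    rw [hτa, locAway_transferH1, hb]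
  simp only [finsum_eq_sum_of_fintype, hterm] at hsum
  -- injectivity of the value currency on the double sum
  rw [← inv_natCast_two_pow] at hsum
  simp only [← sum_val_smul] at hsum
  exact zmod_eq_of_val_smul_eq (N := 2 ^ k) (by rw [hsum, ZMod.val_zero, zero_smul])

variable [Finite ↥(AddSubgroup.torsionBy (Cofree ρ ↥(padicCoeffField S)) ((2 ^ k : ℕ) : ℤ))]
  (t : ∀ w : ↥S₀, galoisCohomology
    (((cofreeTorsionGaloisModule S ρ ((2 ^ k : ℕ) : ℤ)).coind (κ.layerSubgroup n) (κ.isOpen_layerSubgroup n)).toLocal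
      (Sum.inr (w : HeightOneSpectrum (𝓞 ℚ)))) 1)
  (ht : ∀ w : ↥S₀, localTatePairingZMod
      ((cofreeTorsionGaloisModule S ρ ((2 ^ k : ℕ) : ℤ)).coind (κ.layerSubgroup n) (κ.isOpen_layerSubgroup n)) (2 ^ k)
      (Sum.inr (w : HeightOneSpectrum (𝓞 ℚ))) (LocalInvariants.canonical ℚ (2 ^ k) (Sum.inr (w : HeightOneSpectrum (𝓞 ℚ)))) (t w)
      (galoisCohomology.localization
        (((cofreeTorsionGaloisModule S ρ ((2 ^ k : ℕ) : ℤ)).coind (κ.layerSubgroup n) (κ.isOpen_layerSubgroup n)).tateDual (2 ^ k))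
        (Sum.inr (w : HeightOneSpectrum (𝓞 ℚ))) 1
        (cohomologyMap (coindTateDualMor (cofreeTorsionGaloisModule S ρ ((2 ^ k : ℕ) : ℤ))
            (cofreeTorsionGaloisModule S ρ ((2 ^ k : ℕ) : ℤ)) (κ.layerSubgroup n)
            (pairingHomOfFun (2 ^ k) (ePk k) (hμPk k) (hadd₁Pk k) (hadd₂Pk k)) (κ.isOpen_layerSubgroup n)
            (fun σ a' b' => (contPairingOfFun (cofreeTorsionGaloisModule S ρ ((2 ^ k : ℕ) : ℤ)) (2 ^ k) (ePk k) (hμPk k) (hadd₁Pk k)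
              (hadd₂Pk k) (hgalPk k)).toLin_smul σ a' b')) 1
          (shapiroLift (cofreeTorsionGaloisModule S ρ ((2 ^ k : ℕ) : ℤ)).toTopRep (κ.layerSubgroup n) (κ.isOpen_layerSubgroup n)
            hs hs1 a))) =
    ∑ c : Cosets κ (w : HeightOneSpectrum (𝓞 ℚ)), layerPairingH1Of (cofreeTorsionGaloisModule S ρ ((2 ^ k : ℕ) : ℤ)) (2 ^ k) (ePk k)
      (hμPk k) (hadd₁Pk k) (hadd₂Pk k) (hgalPk k) κ w n (b w c)
      (layerLocOf (cofreeTorsionGaloisModule S ρ ((2 ^ k : ℕ) : ℤ)) κ w n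
        (conjMap (cofreeTorsionGaloisModule S ρ ((2 ^ k : ℕ) : ℤ)).toTopRep (κ.layerSubgroup n) c.out 1 a)))

/-! ## §3 The same in p697362's `hT` currency -/

include hρ hv hH hb hur hinf hp ht in
/-- **p697362's `hT` at `(n, k)` from `(H₀)`**: for any family `t w ∈ H¹(ℚ_w, Maps(Γ_ℚ ⧸ Γ_n, A_ρ[2^k]))` (`w : ↥S₀`) whose pairing against
`loc_w(H¹(Ψ)(Sh a))` reads back as the coset sum of layer pairings of the `b w c` against `loc_n(c.out · a)` (the output of
`AwayCharacterReadback.exists_local_of_characters`), `∑ w, ⟨t w, loc_w(H¹(Ψ)(Sh a))⟩_{canonical} = 0` for every test class `a`.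
[cite: MilneADT2006, Ch. I §6 (proof of Prop. 6.9), Thm. 4.10] [cite: Kato2004Asterisque, §13.8 (p. 228)] -/
theorem sum_localTatePairingZMod_eq_zero_of_awayHyp :
    ∑ w : ↥S₀, localTatePairingZMod
      ((cofreeTorsionGaloisModule S ρ ((2 ^ k : ℕ) : ℤ)).coind (κ.layerSubgroup n) (κ.isOpen_layerSubgroup n)) (2 ^ k)
      (Sum.inr (w : HeightOneSpectrum (𝓞 ℚ))) (LocalInvariants.canonical ℚ (2 ^ k) (Sum.inr (w : HeightOneSpectrum (𝓞 ℚ)))) (t w)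
      (galoisCohomology.localization
        (((cofreeTorsionGaloisModule S ρ ((2 ^ k : ℕ) : ℤ)).coind (κ.layerSubgroup n) (κ.isOpen_layerSubgroup n)).tateDual (2 ^ k))
        (Sum.inr (w : HeightOneSpectrum (𝓞 ℚ))) 1
        (cohomologyMap (coindTateDualMor (cofreeTorsionGaloisModule S ρ ((2 ^ k : ℕ) : ℤ))
            (cofreeTorsionGaloisModule S ρ ((2 ^ k : ℕ) : ℤ)) (κ.layerSubgroup n)
            (pairingHomOfFun (2 ^ k) (ePk k) (hμPk k) (hadd₁Pk k) (hadd₂Pk k)) (κ.isOpen_layerSubgroup n)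
            (fun σ a' b' => (contPairingOfFun (cofreeTorsionGaloisModule S ρ ((2 ^ k : ℕ) : ℤ)) (2 ^ k) (ePk k) (hμPk k) (hadd₁Pk k)
              (hadd₂Pk k) (hgalPk k)).toLin_smul σ a' b')) 1
          (shapiroLift (cofreeTorsionGaloisModule S ρ ((2 ^ k : ℕ) : ℤ)).toTopRep (κ.layerSubgroup n) (κ.isOpen_layerSubgroup n)
            hs hs1 a))) = 0 := by
  rw [Finset.sum_congr rfl fun w _ => ht w]
  exact sum_layerPairingH1Of_eq_zero_of_awayHyp S ρ ePk hμPk hadd₁Pk hadd₂Pk hgalPk κ S₀ hρ v hv χ hH n k hs hs1 b hb a hur hinf hp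

end Ortho

end ThetaTransport.AwayOrthogonal

end Summit.BirchSwinnertonDyer.BirchSwinnertonDyer.Theorems

end
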